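/-
Copyright: harness21 operator infrastructure (2026). Not a cell file; not a gate target (HarnessLib/ is outside the
proposal layout and is maintained by direct operator commits).
-/
import Lean.LibrarySuggestions.Basic

/-!
# Build-lane export guard for the CorCM cone (coordinator GO 2026-08-23, evening)

Companion of `HarnessLib.LibrarySuggestionsDenyList` (the `HodgeCM` entry); see that file for the mechanism. Lean 4.32
runs the library-suggestion indexers (`Lean.LibrarySuggestions.SymbolFrequency`, `SineQuaNon`, via their
`exportEntriesFnEx`) over every local theorem constant whenever an `.olean` is written; on the large assembly terms of
the `CorCM` transposition files that costs 5–27 minutes per module (measured in the build lane on 2026-08-23: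
`B01.Transposition.Item6OmegaChiSplitting` 1 613 s, `…Item6SupplyPinnedAssemblyAlongHoldsRestOneOmegaHecke` 1 423 s,
`…Item6HirrOfLemD1AsPrinted` 499 s, `…Item6MuLocalSplittings` 323 s, `…Item6OmegaMuSplittingUnique` 318 s,
`…Item6OmegaMuSplitting` 301 s), while it contributes nothing to the mathematics (premise *suggestions* only).

`Lean/LibrarySuggestions/Basic.lean` (§ `DenyList`) documents the sanctioned switch:

> A premise whose name has one of the following components is not retrieved.
> Use `run_cmd modifyEnv fun env => nameDenyListExt.addEntry env name` to add a name to the deny list.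

The single entry below adds the name component `CorCM` (the CorCM declarations are named
`Summit.HodgeConjecture.CorCM.…`; the *module* deny list is not used because `isDeniedPremise` consults it only for
imported constants, not for the module being exported). It is a persistent environment-extension entry inherited by
every module that imports this one, directly or transitively. Nothing else changes — no statement, proof, attribute,
reducibility setting or option is touched.

Why this file lives under `HarnessLib/Audit/`: the gate regenerates the `HarnessLib.lean` root aggregator from every
module under `lean/HarnessLib/**` except the `HarnessLib.Audit.*` subtree, and `import HarnessLib` has ~27 000
importers; a new top-level HarnessLib module therefore invalidates the whole library (that is what the morning
`HarnessLib.LibrarySuggestionsDenyList` landing did). Modules under `Audit/` stay out of the aggregator, so importing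
this file from one CorCM module rebuilds exactly that module's downstream and nothing else.
-/

run_cmd Lean.modifyEnv (Lean.LibrarySuggestions.nameDenyListExt.addEntry · "CorCM")
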